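import Mathlib
import Summits.KontsevichZagierPeriods.KontsevichZagierPeriods.Theorems.SoloInformedBandTonelli
import Literature.NumberTheory.Transcendental.SemialgebraicMapsProofs
import HarnessLib

/-!
# Solo-informed (A390-ii): the log-room statement and its piece lemmas

File F4a of the KERNEL LEMMA I programme.  We fix the statement `SoloInformedLogRoomAt k m`
("log-room", the family form of THEOREM T'(m)): for a `ℚ`-semialgebraic `S ⊆ ℝᵏ⁺ᵐ`,
`F ≥ 0` and a finite family `ρᵢ` `ℚ`-semialgebraic on `S`, and a parameter `t ∈ ℝᵏ`,
`∫ 1_S F (t, x) dx < ∞` implies `∫ 1_S F (1 + Σᵢ |log ρᵢ|)ᵖ (t, x) dx < ∞`.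

The inductive step (next files) cuts the base of a prepared band into finitely many pieces; this
file proves the three ways a piece is discharged and the bookkeeping around them:

* `soloInformed_piece_lt_top` — a piece carrying a `ℚ`-semialgebraic SURROGATE `F'` with
  `H ≤ K (1 + Σ |log σⱼ|)^{p'} F'` and `F' ≤ K' H₀` is finite by the induction hypothesis;
* `soloInformed_nullPiece_eq_zero` — a piece on which the (finite-integral, measurable) mass
  function `H₀` is infinite is null;
* `soloInformed_zeroPiece_eq_zero` — a piece on which `H` vanishes contributes nothing;
* `soloInformed_cover_lintegral_lt_top` — finiteness over a finite cover;
* `soloInformed_lintegral_indicator_append_finSucc` — splitting off the last variable under a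
  fixed parameter block; measurability of the weighted integrands.
-/

open MeasureTheory Set
open scoped ENNReal
open Literature.ModelTheory.ExponentialFields Literature.NumberTheory.Transcendental
open Literature.NumberTheory.Sieve

namespace Summit.KontsevichZagierPeriods.KontsevichZagierPeriods.Theorems

/-- **Log-room statement `T'(m)`** with `k` parameters and `m` integration variables: finiteness
of `∫ 1_S F (t, ·)` implies finiteness of `∫ 1_S F (1 + Σᵢ |log ρᵢ|)ᵖ (t, ·)` for
`ℚ`-semialgebraic data. -/
def SoloInformedLogRoomAt (k m : ℕ) : Prop :=
  ∀ (ι : Type) [Fintype ι] (p : ℕ) (S : Set (Fin (k + m) → ℝ)) (F : (Fin (k + m) → ℝ) → ℝ)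
    (ρ : ι → (Fin (k + m) → ℝ) → ℝ) (t : Fin k → ℝ),
    IsSemialgebraic ℚ S → IsSemialgebraicFunOn ℚ S F → (∀ i, IsSemialgebraicFunOn ℚ S (ρ i)) →
    (∀ w ∈ S, 0 ≤ F w) →
    ∫⁻ x, ENNReal.ofReal (S.indicator F (Fin.append t x)) < ∞ →
    ∫⁻ x, ENNReal.ofReal (S.indicator (fun w => F w * (1 + ∑ i, |Real.log (ρ i w)|) ^ p)
      (Fin.append t x)) < ∞

/-! ### Pieces -/

/-- **Surrogate piece**: on a `ℚ`-semialgebraic piece `P`, if `H ≤ K · (1 + Σⱼ |log σⱼ|)^{p'} · F'`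
and `F' ≤ K' · H₀` pointwise with `F' ≥ 0`, `σⱼ` `ℚ`-semialgebraic on `P` and `K, K' < ∞`, then
finiteness of `∫ 1_P H₀ (t, ·)` and the log-room statement one dimension down give finiteness of
`∫ 1_P H (t, ·)`. -/
theorem soloInformed_piece_lt_top {k m : ℕ} (ih : SoloInformedLogRoomAt k m)
    {P : Set (Fin (k + m) → ℝ)} (hP : IsSemialgebraic ℚ P) {ι' : Type} [Fintype ι'] {p' : ℕ}
    {F' : (Fin (k + m) → ℝ) → ℝ} {σ : ι' → (Fin (k + m) → ℝ) → ℝ}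
    (hF' : IsSemialgebraicFunOn ℚ P F') (hσ : ∀ j, IsSemialgebraicFunOn ℚ P (σ j))
    (hF'0 : ∀ w ∈ P, 0 ≤ F' w) {H H₀ : (Fin (k + m) → ℝ) → ℝ≥0∞} {K K' : ℝ≥0∞} (hK : K ≠ ∞)
    (hK' : K' ≠ ∞)
    (hH : ∀ w ∈ P, H w ≤
      K * ENNReal.ofReal ((1 + ∑ j, |Real.log (σ j w)|) ^ p') * ENNReal.ofReal (F' w))
    (hH₀ : ∀ w ∈ P, ENNReal.ofReal (F' w) ≤ K' * H₀ w) (t : Fin k → ℝ)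
    (hfin : ∫⁻ x, P.indicator H₀ (Fin.append t x) < ∞) :
    ∫⁻ x, P.indicator H (Fin.append t x) < ∞ := by
  -- finiteness of the surrogate
  have h1 : ∫⁻ x, ENNReal.ofReal (P.indicator F' (Fin.append t x)) < ∞ := by
    calc ∫⁻ x, ENNReal.ofReal (P.indicator F' (Fin.append t x))
        ≤ ∫⁻ x, K' * P.indicator H₀ (Fin.append t x) := by
          refine lintegral_mono fun x => ?_
          by_cases hx : Fin.append t x ∈ P
          · simp only [indicator_of_mem hx]
            exact hH₀ _ hx
          · simp only [indicator_of_notMem hx, ENNReal.ofReal_zero]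
            exact zero_le
      _ = K' * ∫⁻ x, P.indicator H₀ (Fin.append t x) := lintegral_const_mul' _ _ hK'
      _ < ∞ := ENNReal.mul_lt_top (lt_top_iff_ne_top.mpr hK') hfin
  -- the induction hypothesis
  have h2 := ih ι' p' P F' σ t hP hF' hσ hF'0 h1
  calc ∫⁻ x, P.indicator H (Fin.append t x)
      ≤ ∫⁻ x, K * ENNReal.ofReal (P.indicator
          (fun w => F' w * (1 + ∑ j, |Real.log (σ j w)|) ^ p') (Fin.append t x)) := by
        refine lintegral_mono fun x => ?_
        by_cases hx : Fin.append t x ∈ P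
        · simp only [indicator_of_mem hx]
          refine (hH _ hx).trans (le_of_eq ?_)
          rw [mul_assoc, ← ENNReal.ofReal_mul (by positivity), mul_comm ((1 + _) ^ p')]
        · simp only [indicator_of_notMem hx, ENNReal.ofReal_zero, mul_zero]
          exact le_rfl
    _ = K * ∫⁻ x, ENNReal.ofReal (P.indicator
          (fun w => F' w * (1 + ∑ j, |Real.log (σ j w)|) ^ p') (Fin.append t x)) :=
        lintegral_const_mul' _ _ hK
    _ < ∞ := ENNReal.mul_lt_top (lt_top_iff_ne_top.mpr hK) h2

/-- **Null piece**: if the measurable mass function `H₀` has finite integral along `x ↦ (t, x)`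
and is infinite on `P`, then `P` is null along `x ↦ (t, x)` and every `1_P H` integrates to `0`. -/
theorem soloInformed_nullPiece_eq_zero {k m : ℕ} {P : Set (Fin (k + m) → ℝ)}
    {H H₀ : (Fin (k + m) → ℝ) → ℝ≥0∞} (hH₀m : Measurable H₀) (t : Fin k → ℝ)
    (hfin : ∫⁻ x, H₀ (Fin.append t x) < ∞) (htop : ∀ w ∈ P, H₀ w = ∞) :
    ∫⁻ x, P.indicator H (Fin.append t x) = 0 := by
  have hae : ∀ᵐ x : Fin m → ℝ, H₀ (Fin.append t x) < ∞ :=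
    ae_lt_top (hH₀m.comp (FordMaynard.measurable_append_right t)) hfin.ne
  have hae' : ∀ᵐ x : Fin m → ℝ, P.indicator H (Fin.append t x) = 0 := by
    filter_upwards [hae] with x hx
    exact indicator_of_notMem (fun hP => hx.ne (htop _ hP)) _
  rw [lintegral_congr_ae hae', lintegral_zero]

/-- **Zero piece**: if `H` vanishes on `P` then `1_P H` integrates to `0`. -/
theorem soloInformed_zeroPiece_eq_zero {k m : ℕ} {P : Set (Fin (k + m) → ℝ)}
    {H : (Fin (k + m) → ℝ) → ℝ≥0∞} (t : Fin k → ℝ) (hzero : ∀ w ∈ P, H w = 0) :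
    ∫⁻ x, P.indicator H (Fin.append t x) = 0 := by
  have : ∀ x : Fin m → ℝ, P.indicator H (Fin.append t x) = 0 := fun x =>
    indicator_apply_eq_zero.mpr fun hx => hzero _ hx
  simp_rw [this, lintegral_zero]

/-! ### Finite covers -/

/-- **Finiteness over a finite cover**: if `B ⊆ ⋃ᵢ Pᵢ` with measurable pieces and `H` is
measurable, finiteness of each `∫ 1_{Pᵢ} H (t, ·)` gives finiteness of `∫ 1_B H (t, ·)`. -/
theorem soloInformed_cover_lintegral_lt_top {k d : ℕ} {ι : Type} [Finite ι]
    {B : Set (Fin (k + d) → ℝ)} (P : ι → Set (Fin (k + d) → ℝ)) (hcov : B ⊆ ⋃ i, P i)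
    (hPm : ∀ i, MeasurableSet (P i)) {H : (Fin (k + d) → ℝ) → ℝ≥0∞} (hH : Measurable H)
    (t : Fin k → ℝ) (hfin : ∀ i, ∫⁻ x, (P i).indicator H (Fin.append t x) < ∞) :
    ∫⁻ x, B.indicator H (Fin.append t x) < ∞ := by
  haveI := Fintype.ofFinite ι
  have hle : ∀ z, B.indicator H z ≤ ∑ i, (P i).indicator H z := by
    intro z
    by_cases hz : z ∈ B
    · obtain ⟨i, hi⟩ := mem_iUnion.mp (hcov hz)
      rw [indicator_of_mem hz]
      calc H z = (P i).indicator H z := (indicator_of_mem hi _).symm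
        _ ≤ ∑ i, (P i).indicator H z :=
          Finset.single_le_sum (f := fun i => (P i).indicator H z) (fun _ _ => zero_le)
            (Finset.mem_univ i)
    · rw [indicator_of_notMem hz]
      exact zero_le
  calc ∫⁻ x, B.indicator H (Fin.append t x)
      ≤ ∫⁻ x, ∑ i, (P i).indicator H (Fin.append t x) := lintegral_mono fun x => hle _
    _ = ∑ i, ∫⁻ x, (P i).indicator H (Fin.append t x) :=
        lintegral_finsetSum' _ fun i _ =>
          ((hH.indicator (hPm i)).comp (FordMaynard.measurable_append_right t)).aemeasurable
    _ < ∞ := ENNReal.sum_lt_top.mpr fun i _ => hfin i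

/-- Monotonicity in the set: `∫ 1_E H (t, ·) ≤ ∫ 1_S H (t, ·)` for `E ⊆ S`. -/
theorem soloInformed_lintegral_indicator_append_mono {k d : ℕ} {E S : Set (Fin (k + d) → ℝ)}
    (hES : E ⊆ S) (H : (Fin (k + d) → ℝ) → ℝ≥0∞) (t : Fin k → ℝ) :
    ∫⁻ x, E.indicator H (Fin.append t x) ≤ ∫⁻ x, S.indicator H (Fin.append t x) :=
  lintegral_mono fun _ => indicator_le_indicator_of_subset hES (fun _ => zero_le) _

/-! ### Splitting off the last variable under a parameter block -/

/-- For a measurable `D ⊆ ℝᵏ⁺ᵐ⁺¹` and measurable `G ≥ 0`: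
`∫ 1_D G (t, x) dx = ∫ (∫ 1_D G (t, x', y) dy) dx'`. -/
theorem soloInformed_lintegral_indicator_append_finSucc {k m : ℕ} {D : Set (Fin (k + m + 1) → ℝ)}
    (hD : MeasurableSet D) {G : (Fin (k + m + 1) → ℝ) → ℝ≥0∞} (hG : Measurable G)
    (t : Fin k → ℝ) :
    ∫⁻ x : Fin (m + 1) → ℝ, D.indicator G (Fin.append t x : Fin (k + (m + 1)) → ℝ) =
      ∫⁻ x' : Fin m → ℝ, ∫⁻ y, D.indicator G (Fin.snoc (Fin.append t x') y) := by
  have hmeas : Measurable fun x : Fin (m + 1) → ℝ =>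
      D.indicator G (Fin.append t x : Fin (k + (m + 1)) → ℝ) :=
    (hG.indicator hD).comp (FordMaynard.measurable_append_right t)
  rw [soloInformed_lintegral_finSucc m hmeas]
  simp_rw [Fin.append_snoc]

/-- `ENNReal.ofReal` commutes with extension by zero. -/
theorem soloInformed_ofReal_indicator {α : Type*} (E : Set α) (f : α → ℝ) (z : α) :
    ENNReal.ofReal (E.indicator f z) = E.indicator (fun z => ENNReal.ofReal (f z)) z := by
  by_cases hz : z ∈ E
  · simp only [indicator_of_mem hz]
  · simp only [indicator_of_notMem hz, ENNReal.ofReal_zero]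

/-! ### Measurability of the weighted integrands -/

/-- The weighted integrand `1_E · F · (1 + Σᵢ |log ρᵢ|)ᵖ`, `E ⊆ S` measurable, is measurable as
soon as the extensions by zero `1_S F`, `1_S ρᵢ` are. -/
theorem soloInformed_measurable_indicator_logWeight {n : ℕ} {ι : Type} [Fintype ι]
    {S E : Set (Fin n → ℝ)}
    (hES : E ⊆ S) (hE : MeasurableSet E) {F : (Fin n → ℝ) → ℝ} {ρ : ι → (Fin n → ℝ) → ℝ}
    (hF : Measurable (S.indicator F)) (hρ : ∀ i, Measurable (S.indicator (ρ i))) (p : ℕ) :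
    Measurable (E.indicator fun w => F w * (1 + ∑ i, |Real.log (ρ i w)|) ^ p) := by
  have heq : (E.indicator fun w => F w * (1 + ∑ i, |Real.log (ρ i w)|) ^ p) = fun w =>
      E.indicator (fun _ => (1 : ℝ)) w *
        (S.indicator F w * (1 + ∑ i, |Real.log (S.indicator (ρ i) w)|) ^ p) := by
    funext w
    by_cases hw : w ∈ E
    · simp only [indicator_of_mem hw, indicator_of_mem (hES hw), one_mul]
    · simp only [indicator_of_notMem hw, zero_mul]
  rw [heq]
  refine (measurable_const.indicator hE).mul (hF.mul (Measurable.pow_const ?_ p))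
  refine measurable_const.add (Finset.measurable_sum _ fun i _ => ?_)
  exact continuous_abs.measurable.comp (Real.measurable_log.comp (hρ i))

/-- Special case `N = 0`-free form: `1_E F` is measurable for measurable `E ⊆ S` when `1_S F` is. -/
theorem soloInformed_measurable_indicator_of_subset {n : ℕ} {S E : Set (Fin n → ℝ)}
    (hES : E ⊆ S) (hE : MeasurableSet E) {F : (Fin n → ℝ) → ℝ}
    (hF : Measurable (S.indicator F)) : Measurable (E.indicator F) := by
  have heq : E.indicator F = fun w => E.indicator (fun _ => (1 : ℝ)) w * S.indicator F w := by
    funext w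
    by_cases hw : w ∈ E
    · simp only [indicator_of_mem hw, indicator_of_mem (hES hw), one_mul]
    · simp only [indicator_of_notMem hw, zero_mul]
  rw [heq]
  exact (measurable_const.indicator hE).mul hF

/-- Extensions by zero of `ℚ`-semialgebraic functions on `ℚ`-semialgebraic sets are measurable
(packaging of `measurable_indicator_of_tarskiSeidenberg`). -/
theorem soloInformed_measurable_indicator_sa {n : ℕ} {S : Set (Fin n → ℝ)}
    (hS : IsSemialgebraic ℚ S) {F : (Fin n → ℝ) → ℝ} (hF : IsSemialgebraicFunOn ℚ S F) :
    Measurable (S.indicator F) :=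
  hF.measurable_indicator_of_tarskiSeidenberg tarski_seidenberg_real_holds
    (IsSemialgebraic.measurableSet_holds hS)

end Summit.KontsevichZagierPeriods.KontsevichZagierPeriods.Theorems
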